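import Literature.NumberTheory.Connes2026.SeparatedSincKernel
import HarnessLib

/-!
# The separated sinc kernel `1_{x∉Q̃} M κ(M(x−y)) 1_{y∈Q₀}` is square integrable on `ℝ²`, UNIFORMLY in `M`

LABEL (line 1): RH-FREE literature (theorems only; NO definition, NO named fact).  bears_on: LADDER-RH
W-C/W-P (C1 named-fact debt), cell `rh-crit`, sub-cell cc, overflow row O1 — input (iii) of the separated
remainder estimate (S1,S0,S2) of the "annulus road" under `Connes1999_thm_VII_4_rat`: with a margin `δ > 0`
between `Q₀ = Q_{1/p,1}` and `Q̃ = Q_{e^{−δ}/p, e^{δ}}`, `|x − y| ≥ (1 − e^{−δ}) max(|x|, 1/p)` on the support, so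
`|M κ(M(x−y))| ≤ 1/(π|x−y|)` gives an `M`-free square-integrable majorant.  WHAT THIS IS NOT: any claim about
positivity, Weil's criterion or RH.

Sources.  A. Connes, Selecta Math. 5 (1999) [`Connes1999`], §VII eq. (13) and proof of Thm 4 (29)–(33);
A. Connes, C. Consani (2021) [`ConnesConsani2021`], §4 eq. (prolateeq).

## What is proved

* `separatedMajorant`, `integrable_separatedMajorant` — the `M`-free majorant
  `F(x) = 1_{|x| > e^δ} (π(1−e^{−δ})|x|)^{−2} + 1_{|x| ≤ e^{−δ}/p} (p/(π(1−e^{−δ})))²` is integrable (stated inline,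
  no definition);
* **`norm_sq_separatedSinc_le`** — `|1_{x∉Q̃} M κ(M(x−y)) 1_{y∈Q₀}|² ≤ F(x) 1_{Q₀}(y)`;
* **`memLp_separatedSinc`**, **`integral_norm_sq_separatedSinc_le`** — the separated kernel is in `L²(ℝ²)` with
  `∫∫ |·|² ≤ ‖F‖₁ · 2` for every `M > 0`.

No instance, notation or attribute; no `def`.
-/

noncomputable section

open _root_.MeasureTheory Complex Set Filter Function
open scoped Real Topology ComplexConjugate InnerProductSpace

namespace Literature.NumberTheory.Connes2026

open Literature.NumberTheory.LFunctions Literature.Analysis.OperatorTheory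
open Literature.NumberTheory.ConnesConsani
open Literature.NumberTheory.ConnesConsani2024
open Literature.NumberTheory.ConnesConsani2021 hiding cutoffProj cutoffProj_coeFn

variable (p : ℕ) [hp : Fact p.Prime]

/-- **Separation**: for `x ∉ Q̃ = Q_{e^{−δ}/p, e^{δ}}` and `y ∈ Q₀ = Q_{1/p, 1}` (`δ > 0`), either `|x| > e^{δ}` and
`|x − y| ≥ (1 − e^{−δ})|x|`, or `|x| ≤ e^{−δ}/p` and `|x − y| ≥ (1 − e^{−δ})/p`. [cite: Connes1999, §VII proof of Thm 4 eqs. (29)–(33) (arXiv p0013)] -/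
theorem separated_cases {δ x y : ℝ} (hδ : 0 < δ)
    (hx : x ∉ shellSet ((p : ℝ)⁻¹ * Real.exp (-δ)) (Real.exp δ)) (hy : y ∈ shellSet (p : ℝ)⁻¹ 1) :
    (Real.exp δ < |x| ∧ (1 - Real.exp (-δ)) * |x| ≤ |x - y|) ∨
    (|x| ≤ (p : ℝ)⁻¹ * Real.exp (-δ) ∧ (1 - Real.exp (-δ)) * (p : ℝ)⁻¹ ≤ |x - y|) := by
  rw [mem_shellSet_iff, not_and_or, not_lt, not_le] at hx
  rw [mem_shellSet_iff] at hy
  have hp0 : (0 : ℝ) < p := by exact_mod_cast hp.out.pos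
  have hpi : (0 : ℝ) < (p : ℝ)⁻¹ := inv_pos.mpr hp0
  have he : Real.exp (-δ) < 1 := Real.exp_lt_one_iff.mpr (by linarith)
  have he0 : 0 < Real.exp (-δ) := Real.exp_pos _
  have hee : Real.exp (-δ) * Real.exp δ = 1 := by rw [← Real.exp_add, neg_add_cancel, Real.exp_zero]
  rcases hx with hx | hx
  · right
    refine ⟨hx, ?_⟩
    -- `|x − y| ≥ |y| − |x| > 1/p − e^{−δ}/p`
    have h1 : |y| - |x| ≤ |x - y| := by
      have := abs_sub_abs_le_abs_sub y x
      rwa [abs_sub_comm] at this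
    nlinarith
  · left
    refine ⟨hx, ?_⟩
    -- `|x − y| ≥ |x| − |y| ≥ |x| − 1 ≥ |x| − e^{−δ}|x|`
    have h1 : |x| - |y| ≤ |x - y| := abs_sub_abs_le_abs_sub x y
    have h2 : (1 : ℝ) ≤ Real.exp (-δ) * |x| := by
      have := mul_le_mul_of_nonneg_left hx.le he0.le
      rw [hee] at this
      exact this
    nlinarith

/-- **The pointwise majorant**: `‖1_{x∉Q̃} M κ(M(x−y)) 1_{y∈Q₀}‖² ≤ F(x) · 1_{Q₀}(y)` with the `M`-free
`F(x) = 1_{|x|>e^δ} (π(1−e^{−δ})|x|)^{−2} + 1_{|x| ≤ e^{−δ}/p} (π(1−e^{−δ})/p)^{−2}` (a function of `|x|`). [cite: Connes1999, §VII proof of Thm 4 eqs. (29)–(33) (arXiv p0013); ConnesConsani2021, §4 eq. (prolateeq)] -/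
theorem norm_sq_separatedSinc_le {δ M : ℝ} (hδ : 0 < δ) (hM : 0 < M) (x y : ℝ) :
    ‖(shellSet ((p : ℝ)⁻¹ * Real.exp (-δ)) (Real.exp δ))ᶜ.indicator (fun _ => (1 : ℂ)) x *
        ((M : ℂ) * sincKernel (M * (x - y))) * (shellSet (p : ℝ)⁻¹ 1).indicator (fun _ => (1 : ℂ)) y‖ ^ 2 ≤
      ((Set.Ioi (Real.exp δ)).indicator (fun t => ((π * (1 - Real.exp (-δ)) * t) ^ 2)⁻¹) |x| +
        (Set.Iic ((p : ℝ)⁻¹ * Real.exp (-δ))).indicator (fun _ => ((π * (1 - Real.exp (-δ)) * (p : ℝ)⁻¹) ^ 2)⁻¹) |x|) *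
      (shellSet (p : ℝ)⁻¹ 1).indicator (fun _ => (1 : ℝ)) y := by
  have he : Real.exp (-δ) < 1 := Real.exp_lt_one_iff.mpr (by linarith)
  have hp0 : (0 : ℝ) < p := by exact_mod_cast hp.out.pos
  have hpi : (0 : ℝ) < (p : ℝ)⁻¹ := inv_pos.mpr hp0
  have hF : 0 ≤ (Set.Ioi (Real.exp δ)).indicator (fun t => ((π * (1 - Real.exp (-δ)) * t) ^ 2)⁻¹) |x| +
      (Set.Iic ((p : ℝ)⁻¹ * Real.exp (-δ))).indicator (fun _ => ((π * (1 - Real.exp (-δ)) * (p : ℝ)⁻¹) ^ 2)⁻¹) |x| :=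
    add_nonneg (Set.indicator_nonneg (fun _ _ => by positivity) _) (Set.indicator_nonneg (fun _ _ => by positivity) _)
  by_cases hy : y ∈ shellSet (p : ℝ)⁻¹ 1
  swap
  · rw [Set.indicator_of_notMem hy, mul_zero, norm_zero, Set.indicator_of_notMem hy, mul_zero]
    simp
  rw [Set.indicator_of_mem hy, mul_one, Set.indicator_of_mem hy, mul_one]
  by_cases hx : x ∈ shellSet ((p : ℝ)⁻¹ * Real.exp (-δ)) (Real.exp δ)
  · rw [Set.indicator_of_notMem (Set.notMem_compl_iff.mpr hx), zero_mul, norm_zero]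
    simpa using hF
  rw [Set.indicator_of_mem (Set.mem_compl hx), one_mul]
  have hxy : x - y ≠ 0 := by
    intro h
    have : x = y := sub_eq_zero.mp h
    rw [this, mem_shellSet_iff] at hx
    rw [mem_shellSet_iff] at hy
    apply hx
    constructor
    · calc (p : ℝ)⁻¹ * Real.exp (-δ) < (p : ℝ)⁻¹ * 1 := mul_lt_mul_of_pos_left he hpi
        _ = (p : ℝ)⁻¹ := mul_one _
        _ < |y| := hy.1
    · exact hy.2.trans (Real.one_le_exp hδ.le)
  have hb := norm_dilatedSinc_le hM hxy
  have hb2 : ‖(M : ℂ) * sincKernel (M * (x - y))‖ ^ 2 ≤ (1 / (π * |x - y|)) ^ 2 :=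
    pow_le_pow_left₀ (norm_nonneg _) hb 2
  rcases separated_cases p hδ hx hy with ⟨hx1, hsep⟩ | ⟨hx1, hsep⟩
  · rw [Set.indicator_of_mem (Set.mem_Ioi.mpr hx1), Set.indicator_of_notMem (by
      rw [Set.mem_Iic, not_le]
      calc (p : ℝ)⁻¹ * Real.exp (-δ) < (p : ℝ)⁻¹ * 1 := mul_lt_mul_of_pos_left he hpi
        _ ≤ 1 := by rw [mul_one]; exact inv_le_one_of_one_le₀ (by exact_mod_cast hp.out.one_lt.le)
        _ ≤ Real.exp δ := Real.one_le_exp hδ.le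
        _ < |x| := hx1), add_zero]
    refine hb2.trans ?_
    have hpos : 0 < π * (1 - Real.exp (-δ)) * |x| := by
      have : 0 < |x| := (Real.exp_pos δ).trans hx1
      have : 0 < 1 - Real.exp (-δ) := by linarith
      positivity
    rw [div_pow, one_pow, one_div]
    have hle : π * (1 - Real.exp (-δ)) * |x| ≤ π * |x - y| := by
      have := mul_le_mul_of_nonneg_left hsep Real.pi_pos.le
      linarith [this]
    exact inv_anti₀ (pow_pos hpos 2) (pow_le_pow_left₀ hpos.le hle 2)
  · rw [Set.indicator_of_mem (Set.mem_Iic.mpr hx1), Set.indicator_of_notMem (by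
      rw [Set.mem_Ioi, not_lt]
      calc |x| ≤ (p : ℝ)⁻¹ * Real.exp (-δ) := hx1
        _ ≤ 1 * 1 := mul_le_mul (inv_le_one_of_one_le₀ (by exact_mod_cast hp.out.one_lt.le)) he.le
            (Real.exp_pos _).le zero_le_one
        _ ≤ Real.exp δ := by rw [mul_one]; exact Real.one_le_exp hδ.le), zero_add]
    refine hb2.trans ?_
    have hpos : 0 < π * (1 - Real.exp (-δ)) * (p : ℝ)⁻¹ := by
      have : 0 < 1 - Real.exp (-δ) := by linarith
      positivity
    rw [div_pow, one_pow, one_div]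
    have hle : π * (1 - Real.exp (-δ)) * (p : ℝ)⁻¹ ≤ π * |x - y| := by
      have := mul_le_mul_of_nonneg_left hsep Real.pi_pos.le
      linarith [this]
    exact inv_anti₀ (pow_pos hpos 2) (pow_le_pow_left₀ hpos.le hle 2)

/-! ## §3. Integrability of the majorant and the uniform `L²` bound -/

omit hp in
/-- `x ↦ (|x|²)⁻¹` is integrable on `{|x| > c}` for `c > 0`. [cite: Connes1999, §VII proof of Thm 4 (arXiv p0013)] -/
theorem integrableOn_inv_abs_sq {c : ℝ} (hc : 0 < c) :
    IntegrableOn (fun x : ℝ => (|x| ^ 2)⁻¹) {x | c < |x|} volume := by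
  have hset : {x : ℝ | c < |x|} = Set.Ioi c ∪ Set.Iio (-c) := by
    ext x
    simp only [Set.mem_setOf_eq, Set.mem_union, Set.mem_Ioi, Set.mem_Iio]
    rcases le_or_gt 0 x with h | h
    · rw [abs_of_nonneg h]; constructor
      · intro h1; exact Or.inl h1
      · rintro (h1 | h1)
        · exact h1
        · linarith
    · rw [abs_of_neg h]; constructor
      · intro h1; exact Or.inr (by linarith)
      · rintro (h1 | h1)
        · linarith
        · linarith
  have hIoi : IntegrableOn (fun x : ℝ => (|x| ^ 2)⁻¹) (Set.Ioi c) volume := by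
    refine (integrableOn_Ioi_rpow_of_lt (by norm_num : (-2 : ℝ) < -1) hc).congr_fun (fun x hx => ?_)
      measurableSet_Ioi
    have hx0 : 0 < x := hc.trans hx
    show x ^ (-2 : ℝ) = (|x| ^ 2)⁻¹
    rw [abs_of_pos hx0, Real.rpow_neg hx0.le, show (2 : ℝ) = ((2 : ℕ) : ℝ) by norm_num, Real.rpow_natCast]
  have hIio : IntegrableOn (fun x : ℝ => (|x| ^ 2)⁻¹) (Set.Iio (-c)) volume := by
    have h := ((Measure.measurePreserving_neg (volume : Measure ℝ)).integrableOn_comp_preimage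
      (Homeomorph.neg ℝ).measurableEmbedding (f := fun x : ℝ => (|x| ^ 2)⁻¹) (s := Set.Ioi c)).2 hIoi
    have hpre : (Neg.neg ⁻¹' Set.Ioi c : Set ℝ) = Set.Iio (-c) := by
      ext x; simp only [Set.mem_preimage, Set.mem_Ioi, Set.mem_Iio]; constructor <;> intro h <;> linarith
    have hfun : ((fun x : ℝ => (|x| ^ 2)⁻¹) ∘ Neg.neg) = fun x : ℝ => (|x| ^ 2)⁻¹ := by
      funext x; simp only [Function.comp, abs_neg]
    rw [hpre, hfun] at h
    exact h
  rw [hset]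
  exact hIoi.union hIio

omit hp in
/-- **The majorant is integrable.** [cite: Connes1999, §VII proof of Thm 4 (arXiv p0013)] -/
theorem integrable_separatedMajorant (δ : ℝ) :
    Integrable (fun x : ℝ =>
      (Set.Ioi (Real.exp δ)).indicator (fun t => ((π * (1 - Real.exp (-δ)) * t) ^ 2)⁻¹) |x| +
        (Set.Iic ((p : ℝ)⁻¹ * Real.exp (-δ))).indicator
          (fun _ => ((π * (1 - Real.exp (-δ)) * (p : ℝ)⁻¹) ^ 2)⁻¹) |x|) := by
  refine Integrable.add ?_ ?_
  · have h1 : (fun x : ℝ => (Set.Ioi (Real.exp δ)).indicator (fun t => ((π * (1 - Real.exp (-δ)) * t) ^ 2)⁻¹) |x|) =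
        {x : ℝ | Real.exp δ < |x|}.indicator (fun x => ((π * (1 - Real.exp (-δ))) ^ 2)⁻¹ * (|x| ^ 2)⁻¹) := by
      funext x
      by_cases hx : Real.exp δ < |x|
      · rw [Set.indicator_of_mem (Set.mem_Ioi.mpr hx), Set.indicator_of_mem (by exact hx), mul_pow, mul_inv]
      · rw [Set.indicator_of_notMem (fun h => hx (Set.mem_Ioi.mp h)), Set.indicator_of_notMem (by exact hx)]
    rw [h1, integrable_indicator_iff (measurableSet_lt measurable_const (continuous_abs.measurable))]
    exact (integrableOn_inv_abs_sq (Real.exp_pos δ)).const_mul _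
  · have h1 : (fun x : ℝ => (Set.Iic ((p : ℝ)⁻¹ * Real.exp (-δ))).indicator
          (fun _ => ((π * (1 - Real.exp (-δ)) * (p : ℝ)⁻¹) ^ 2)⁻¹) |x|) =
        (Set.Icc (-((p : ℝ)⁻¹ * Real.exp (-δ))) ((p : ℝ)⁻¹ * Real.exp (-δ))).indicator
          (fun _ => ((π * (1 - Real.exp (-δ)) * (p : ℝ)⁻¹) ^ 2)⁻¹) := by
      funext x
      by_cases hx : |x| ≤ (p : ℝ)⁻¹ * Real.exp (-δ)
      · rw [Set.indicator_of_mem (Set.mem_Iic.mpr hx), Set.indicator_of_mem (Set.mem_Icc.mpr (abs_le.mp hx))]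
      · rw [Set.indicator_of_notMem (fun h => hx (Set.mem_Iic.mp h)),
          Set.indicator_of_notMem (fun h => hx (abs_le.mpr (Set.mem_Icc.mp h)))]
    rw [h1, integrable_indicator_iff measurableSet_Icc]
    exact integrableOn_const (by rw [Real.volume_Icc]; exact ENNReal.ofReal_ne_top)

/-! ## §4. The separated kernel is in `L²(ℝ²)`, uniformly in `M` -/

omit hp in
/-- Measurability of the separated kernel. [cite: Connes1999, §VII eq. (13) (arXiv p0013)] -/
theorem measurable_separatedSinc (δ M : ℝ) :
    Measurable (uncurry fun x y : ℝ =>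
      (shellSet ((p : ℝ)⁻¹ * Real.exp (-δ)) (Real.exp δ))ᶜ.indicator (fun _ => (1 : ℂ)) x *
        ((M : ℂ) * sincKernel (M * (x - y))) * (shellSet (p : ℝ)⁻¹ 1).indicator (fun _ => (1 : ℂ)) y) := by
  refine Measurable.mul (Measurable.mul ?_ ?_) ?_
  · exact (measurable_const.indicator (measurableSet_shellSet _ _).compl).comp measurable_fst
  · exact measurable_const.mul
      (continuous_sincKernel.measurable.comp (measurable_const.mul (measurable_fst.sub measurable_snd)))
  · exact (measurable_const.indicator (measurableSet_shellSet _ _)).comp measurable_snd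

omit hp in
/-- The indicator of `Q₀` is integrable. [cite: Connes1999, §VII eq. (12) (arXiv p0013)] -/
theorem integrable_indicator_shellSet (a b : ℝ) :
    Integrable (fun y : ℝ => (shellSet a b).indicator (fun _ => (1 : ℝ)) y) := by
  rw [integrable_indicator_iff (measurableSet_shellSet a b)]
  refine integrableOn_const ?_
  refine ((measure_mono (fun y hy => ?_ : shellSet a b ⊆ Set.Icc (-b) b)).trans_lt
    (by rw [Real.volume_Icc]; exact ENNReal.ofReal_lt_top)).ne
  exact Set.mem_Icc.mpr (abs_le.mp ((mem_shellSet_iff.mp hy).2))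

/-- **The separated sinc kernel is square integrable on `ℝ²`, for every `M > 0`** (dominated by the `M`-free
majorant `F(x) 1_{Q₀}(y)`). [cite: Connes1999, §VII eq. (13) and proof of Thm 4 eqs. (29)–(33) (arXiv p0013); ConnesConsani2021, §4 eq. (prolateeq)] -/
theorem memLp_separatedSinc {δ M : ℝ} (hδ : 0 < δ) (hM : 0 < M) :
    MemLp (uncurry fun x y : ℝ =>
      (shellSet ((p : ℝ)⁻¹ * Real.exp (-δ)) (Real.exp δ))ᶜ.indicator (fun _ => (1 : ℂ)) x *
        ((M : ℂ) * sincKernel (M * (x - y))) * (shellSet (p : ℝ)⁻¹ 1).indicator (fun _ => (1 : ℂ)) y) 2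
      ((volume : Measure ℝ).prod (volume : Measure ℝ)) := by
  have hmeas := (measurable_separatedSinc p δ M).aestronglyMeasurable
    (μ := (volume : Measure ℝ).prod (volume : Measure ℝ))
  rw [memLp_two_iff_integrable_sq_norm hmeas]
  refine Integrable.mono' ((integrable_separatedMajorant p δ).mul_prod (integrable_indicator_shellSet (p : ℝ)⁻¹ 1))
    (hmeas.norm.pow 2) (ae_of_all _ fun z => ?_)
  rw [Real.norm_eq_abs, abs_of_nonneg (sq_nonneg _)]
  exact norm_sq_separatedSinc_le p hδ hM z.1 z.2

/-- **The uniform bound**: `∫∫ |1_{x∉Q̃} M κ(M(x−y)) 1_{y∈Q₀}|² ≤ (∫ F) · (∫ 1_{Q₀})`, independent of `M > 0`. [cite: Connes1999, §VII proof of Thm 4 eqs. (29)–(33) (arXiv p0013)] -/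
theorem integral_norm_sq_separatedSinc_le {δ M : ℝ} (hδ : 0 < δ) (hM : 0 < M) :
    ∫ z, ‖(uncurry fun x y : ℝ =>
      (shellSet ((p : ℝ)⁻¹ * Real.exp (-δ)) (Real.exp δ))ᶜ.indicator (fun _ => (1 : ℂ)) x *
        ((M : ℂ) * sincKernel (M * (x - y))) * (shellSet (p : ℝ)⁻¹ 1).indicator (fun _ => (1 : ℂ)) y) z‖ ^ 2
      ∂((volume : Measure ℝ).prod (volume : Measure ℝ)) ≤
    (∫ x : ℝ, (Set.Ioi (Real.exp δ)).indicator (fun t => ((π * (1 - Real.exp (-δ)) * t) ^ 2)⁻¹) |x| +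
        (Set.Iic ((p : ℝ)⁻¹ * Real.exp (-δ))).indicator
          (fun _ => ((π * (1 - Real.exp (-δ)) * (p : ℝ)⁻¹) ^ 2)⁻¹) |x|) *
      ∫ y : ℝ, (shellSet (p : ℝ)⁻¹ 1).indicator (fun _ => (1 : ℝ)) y := by
  rw [← integral_prod_mul]
  refine integral_mono_of_nonneg (ae_of_all _ fun z => sq_nonneg _)
    ((integrable_separatedMajorant p δ).mul_prod (integrable_indicator_shellSet (p : ℝ)⁻¹ 1))
    (ae_of_all _ fun z => ?_)
  exact norm_sq_separatedSinc_le p hδ hM z.1 z.2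

/-! ## §5. The geometric (rank-one) expansion of the Cauchy kernel on the separated region

On the support of the separated kernel either `|y| ≤ 1 < e^{δ} < |x|` or `|x| ≤ e^{−δ}/p < 1/p < |y|`; in the
first case `1/(x − y) = Σ_n y^n / x^{n+1}`, in the second `1/(x − y) = −Σ_n x^n / y^{n+1}`, with ratio
`≤ e^{−δ}` — the expansion that makes `(1 − Q̃) P̂⁰_M Q₀ = Im[e^{2πiMx} · (1/(π(x−y))) · e^{−2πiMy}]` a sum of
rank-one operators with `M`-independent nuclear norm (S-plan step (iv)). -/

omit hp in
/-- **Outer expansion**: `|y| < |x| ⇒ Σ_n y^n / x^{n+1} = 1/(x − y)`. [cite: Connes1999, §VII proof of Thm 4 eqs. (29)–(33) (arXiv p0013)] -/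
theorem hasSum_inv_sub_outer {x y : ℝ} (h : |y| < |x|) :
    HasSum (fun n : ℕ => y ^ n / x ^ (n + 1)) (x - y)⁻¹ := by
  have hx : x ≠ 0 := by
    intro hx; rw [hx, abs_zero] at h; exact not_lt.mpr (abs_nonneg y) h
  have hr : ‖y / x‖ < 1 := by
    rw [Real.norm_eq_abs, abs_div, div_lt_one ((abs_pos.mpr hx))]
    exact h
  have hg := (hasSum_geometric_of_norm_lt_one hr).mul_left x⁻¹
  have hxy : x - y ≠ 0 := by
    intro h0
    have : x = y := sub_eq_zero.mp h0
    rw [this] at h; exact lt_irrefl _ h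
  have hval : x⁻¹ * (1 - y / x)⁻¹ = (x - y)⁻¹ := by
    rw [← mul_inv]
    congr 1
    field_simp
  rw [hval] at hg
  refine hg.congr_fun fun n => ?_
  rw [div_pow, pow_succ]
  field_simp

omit hp in
/-- **Inner expansion**: `|x| < |y| ⇒ Σ_n −x^n / y^{n+1} = 1/(x − y)`. [cite: Connes1999, §VII proof of Thm 4 eqs. (29)–(33) (arXiv p0013)] -/
theorem hasSum_inv_sub_inner {x y : ℝ} (h : |x| < |y|) :
    HasSum (fun n : ℕ => -(x ^ n / y ^ (n + 1))) (x - y)⁻¹ := by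
  have h1 := (hasSum_inv_sub_outer h).neg
  have hval : -(y - x)⁻¹ = (x - y)⁻¹ := by
    rw [← inv_neg, neg_sub]
  rw [hval] at h1
  exact h1

omit hp in
/-- The ratio bound on the outer region: `|y| ≤ 1`, `e^{δ} < |x|` ⇒ `|y/x| ≤ e^{−δ}` and
`|y^n / x^{n+1}| ≤ e^{−δ n} / |x|`. [cite: Connes1999, §VII proof of Thm 4 eqs. (29)–(33) (arXiv p0013)] -/
theorem abs_term_outer_le {δ x y : ℝ} (hx : Real.exp δ < |x|) (hy : |y| ≤ 1) (n : ℕ) :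
    |y ^ n / x ^ (n + 1)| ≤ Real.exp (-δ) ^ n / |x| := by
  have hx0 : 0 < |x| := (Real.exp_pos δ).trans hx
  have hratio : |y| / |x| ≤ Real.exp (-δ) := by
    rw [div_le_iff₀ hx0, Real.exp_neg]
    calc |y| ≤ 1 := hy
      _ = (Real.exp δ)⁻¹ * Real.exp δ := by rw [inv_mul_cancel₀ (Real.exp_pos δ).ne']
      _ ≤ (Real.exp δ)⁻¹ * |x| := mul_le_mul_of_nonneg_left hx.le (inv_nonneg.mpr (Real.exp_pos δ).le)
  rw [abs_div, abs_pow, abs_pow, pow_succ, ← div_div, div_le_div_iff_of_pos_right hx0, ← div_pow]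
  exact pow_le_pow_left₀ (div_nonneg (abs_nonneg _) hx0.le) hratio n

omit hp in
/-- The ratio bound on the inner region: `|x| ≤ e^{−δ}/p`, `1/p < |y|` ⇒ `|x^n / y^{n+1}| ≤ e^{−δ n} / |y|`. [cite: Connes1999, §VII proof of Thm 4 eqs. (29)–(33) (arXiv p0013)] -/
theorem abs_term_inner_le {δ x y : ℝ} {p' : ℝ} (hp' : 0 < p') (hx : |x| ≤ p'⁻¹ * Real.exp (-δ)) (hy : p'⁻¹ < |y|)
    (n : ℕ) : |x ^ n / y ^ (n + 1)| ≤ Real.exp (-δ) ^ n / |y| := by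
  have hy0 : 0 < |y| := (inv_pos.mpr hp').trans hy
  have hratio : |x| / |y| ≤ Real.exp (-δ) := by
    rw [div_le_iff₀ hy0]
    calc |x| ≤ p'⁻¹ * Real.exp (-δ) := hx
      _ ≤ |y| * Real.exp (-δ) := mul_le_mul_of_nonneg_right hy.le (Real.exp_pos _).le
      _ = Real.exp (-δ) * |y| := mul_comm _ _
  rw [abs_div, abs_pow, abs_pow, pow_succ, ← div_div, div_le_div_iff_of_pos_right hy0, ← div_pow]
  exact pow_le_pow_left₀ (div_nonneg (abs_nonneg _) hy0.le) hratio n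

/-! ## §6. `L²` bounds for the factors of the rank-one expansion -/

omit hp in
/-- A set integral of a function bounded by `C` on a set of finite measure is at most `C · |s|`. [cite: Connes1999, §VII proof of Thm 4 (arXiv p0013)] -/
theorem setIntegral_le_of_le_const {s : Set ℝ} {f : ℝ → ℝ} {C : ℝ} (hs : volume s < ⊤)
    (hC : ∀ x ∈ s, ‖f x‖ ≤ C) : ∫ x in s, f x ≤ C * (volume : Measure ℝ).real s :=
  (le_abs_self _).trans ((Real.norm_eq_abs _).symm.le.trans (norm_setIntegral_le_of_norm_le_const hs hC))

omit hp in
/-- `|Q₀| ≤ 2` (`Q₀ = Q_{1/p,1} ⊆ [−1, 1]`). [cite: Connes1999, §VII eq. (12) (arXiv p0013)] -/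
theorem volume_real_shellSet_le : (volume : Measure ℝ).real (shellSet (p : ℝ)⁻¹ 1) ≤ 2 := by
  have hsub : shellSet (p : ℝ)⁻¹ 1 ⊆ Set.Icc (-1 : ℝ) 1 := fun y hy =>
    Set.mem_Icc.mpr (abs_le.mp (mem_shellSet_iff.mp hy).2)
  calc (volume : Measure ℝ).real (shellSet (p : ℝ)⁻¹ 1) ≤ (volume : Measure ℝ).real (Set.Icc (-1 : ℝ) 1) :=
        measureReal_mono hsub (by rw [Real.volume_Icc]; exact ENNReal.ofReal_ne_top)
    _ = 2 := by rw [Real.volume_real_Icc_of_le (by norm_num)]; norm_num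

omit hp in
/-- `Q₀` has finite measure. [cite: Connes1999, §VII eq. (12) (arXiv p0013)] -/
theorem volume_shellSet_lt_top (a b : ℝ) : volume (shellSet a b) < ⊤ :=
  (measure_mono (fun y hy => Set.mem_Icc.mpr (abs_le.mp (mem_shellSet_iff.mp hy).2) :
    shellSet a b ⊆ Set.Icc (-b) b)).trans_lt (by rw [Real.volume_Icc]; exact ENNReal.ofReal_lt_top)

omit hp in
/-- **`∫_{Q₀} y^{2n} dy ≤ 2`.** [cite: Connes1999, §VII proof of Thm 4 eqs. (29)–(33) (arXiv p0013)] -/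
theorem setIntegral_pow_sq_shellSet_le (n : ℕ) :
    ∫ y in shellSet (p : ℝ)⁻¹ 1, (y ^ n) ^ 2 ≤ 2 := by
  have h := setIntegral_le_of_le_const (f := fun y : ℝ => (y ^ n) ^ 2) (C := 1)
    (volume_shellSet_lt_top (p : ℝ)⁻¹ 1) (fun y hy => by
      rw [Real.norm_eq_abs, abs_of_nonneg (sq_nonneg _), ← sq_abs, abs_pow, ← pow_mul]
      exact pow_le_one₀ (abs_nonneg _) (mem_shellSet_iff.mp hy).2)
  have h2 := volume_real_shellSet_le p
  linarith

/-- **`∫_{Q₀} y^{−2(n+1)} dy ≤ 2 p^{2(n+1)}`** (`|y| > 1/p` on `Q₀`). [cite: Connes1999, §VII proof of Thm 4 eqs. (29)–(33) (arXiv p0013)] -/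
theorem setIntegral_inv_pow_sq_shellSet_le (n : ℕ) :
    ∫ y in shellSet (p : ℝ)⁻¹ 1, ((y ^ (n + 1))⁻¹) ^ 2 ≤ 2 * (p : ℝ) ^ (2 * (n + 1)) := by
  have hp0 : (0 : ℝ) < p := by exact_mod_cast hp.out.pos
  have h := setIntegral_le_of_le_const (f := fun y : ℝ => ((y ^ (n + 1))⁻¹) ^ 2) (C := (p : ℝ) ^ (2 * (n + 1)))
    (volume_shellSet_lt_top (p : ℝ)⁻¹ 1) (fun y hy => by
      have hy1 := (mem_shellSet_iff.mp hy).1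
      have hy0 : 0 < |y| := (inv_pos.mpr hp0).trans hy1
      rw [Real.norm_eq_abs, abs_of_nonneg (sq_nonneg _), ← sq_abs, abs_inv, abs_pow, ← inv_pow, ← pow_mul,
        mul_comm]
      refine pow_le_pow_left₀ (inv_nonneg.mpr hy0.le) ?_ _
      rw [inv_le_comm₀ hy0 hp0]
      exact hy1.le)
  have h2 := volume_real_shellSet_le p
  have h3 : 0 ≤ (p : ℝ) ^ (2 * (n + 1)) := by positivity
  nlinarith

omit hp in
/-- **`∫_{|x| ≤ c} x^{2n} dx ≤ 2c · c^{2n}`** (`c ≥ 0`). [cite: Connes1999, §VII proof of Thm 4 eqs. (29)–(33) (arXiv p0013)] -/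
theorem setIntegral_pow_sq_Icc_le {c : ℝ} (hc : 0 ≤ c) (n : ℕ) :
    ∫ x in Set.Icc (-c) c, (x ^ n) ^ 2 ≤ c ^ (2 * n) * (2 * c) := by
  have h := setIntegral_le_of_le_const (s := Set.Icc (-c) c) (f := fun x : ℝ => (x ^ n) ^ 2) (C := c ^ (2 * n))
    (by rw [Real.volume_Icc]; exact ENNReal.ofReal_lt_top) (fun x hx => by
      rw [Real.norm_eq_abs, abs_of_nonneg (sq_nonneg _), ← sq_abs, abs_pow, ← pow_mul, mul_comm]
      exact pow_le_pow_left₀ (abs_nonneg _) (abs_le.mpr (Set.mem_Icc.mp hx)) _)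
  rwa [Real.volume_real_Icc_of_le (by linarith), show c - -c = 2 * c by ring] at h

omit hp in
/-- **`∫_{x > c} x^{−2(n+1)} dx = c^{−(2n+1)}/(2n+1)`** (`c > 0`). [cite: Connes1999, §VII proof of Thm 4 eqs. (29)–(33) (arXiv p0013)] -/
theorem setIntegral_Ioi_inv_pow_sq {c : ℝ} (hc : 0 < c) (n : ℕ) :
    ∫ x in Set.Ioi c, ((x ^ (n + 1))⁻¹) ^ 2 = c ^ (-(2 * (n : ℝ) + 1)) / (2 * n + 1) := by
  have h1 : ∫ x in Set.Ioi c, ((x ^ (n + 1))⁻¹) ^ 2 = ∫ x in Set.Ioi c, x ^ (-(2 * (n : ℝ) + 2)) := by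
    refine setIntegral_congr_fun measurableSet_Ioi fun x hx => ?_
    have hx0 : 0 < x := hc.trans hx
    rw [← inv_pow, ← pow_mul, Real.rpow_neg hx0.le, show (2 * (n : ℝ) + 2) = ((((n + 1) * 2 : ℕ)) : ℝ) by
      push_cast; ring, Real.rpow_natCast, inv_pow]
  rw [h1, integral_Ioi_rpow_of_lt (by linarith [Nat.cast_nonneg (α := ℝ) n] : -(2 * (n : ℝ) + 2) < -1) hc]
  rw [show -(2 * (n : ℝ) + 2) + 1 = -(2 * (n : ℝ) + 1) by ring]
  field_simp

end Literature.NumberTheory.Connes2026
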